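import Summits.NavierStokesRegularity.NavierStokesRegularity.Theorems.EulerZoomLiouvillePowerGaugeEulerLiouvilleNeedleOscillationTame
import HarnessLib

/-!
# Crux E `PowerGaugeEulerLiouville` (stmt-NavierStokesRegularity-19832) — CORE PERSISTENCE AT A POLYNOMIAL SCALE IS TAME
# (the thin-core portrait as a KILL, sharpest kinematic form: hypothesis only at the fast-inflow points, radial component only, one-sided)

Route №10 `EulerZoomLiouville` (NavierStokesRegularity), crux E, THE ONE STATEMENT `stub_selfSimilarC2Needle`; ns-ezl-w1 g2 (fourth file
of the needle-kill family `…NeedleGradientGrowth` ⊂ `…NeedleOscillationTame` ⊂ THIS).  The needle-thinness kernel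
(`NeedleThinness.needle_inradius_le_radial`, nsreg-p2 g31) needs exactly one thing at a fast-inflow point `y` (`⟪y, V y⟫ < −κ‖y‖²`,
`‖y‖ = s` large): that the RADIAL inflow PERSISTS at half strength, `⟪y, V y'⟫ ≤ −(κ/2)‖y‖²`, on a ball `B(y, r)` of polynomially
small radius `r = K‖y‖^{1−q}`, `q < 2 + ρ`.  So the honest tame stratum is

  (CoreP)  `∀ y, R₀ ≤ ‖y‖ → ⟪y, V y⟫ < −κ‖y‖² → ∀ y', ‖y' − y‖ ≤ K‖y‖^{1−q} → ⟪y, V y'⟫ ≤ −(κ/2)‖y‖²`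

— nothing is asked away from the fast-inflow points, nothing about the tangential components, and only one side of the radial one.

* `radialBarrier_of_corePersistence` — PROFILE THEOREM: `C¹` + A-growth + op-norm E-weight + (CoreP) (`K > 0`, `q < 2+ρ`, `κ > 0`)
  ⇒ `−κ‖y‖² ≤ ⟪y, V y⟫` for all large `‖y‖` (i.e. there are NO fast-inflow points far out: every polynomially thick core is fatal);
* `selfSimilar_ae_eq_zero_of_corePersistence` — MEMBER COROLLARY (crux binders verbatim + exact self-similarity + `C²` + (CoreP) at some
  `κ < γ = 1/(2+ρ)`): trivial, via `Loc.selfSimilar_ae_eq_zero_of_radialInflowC2_profile`;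
* `corePersistence_of_oscTame` — (Osc) of `…NeedleOscillationTame` ⇒ (CoreP) (so that file, `…NeedleGradientGrowth` and the UC disjunct
  are instances).

Registered consequence: the surviving needle of THE ONE STATEMENT has, at its fast-inflow points `y` on every large sphere, radial
inflow that DROPS below half strength within distance `K‖y‖^{1−q}` for EVERY `K > 0`, `q < 2+ρ` — its cores are thinner than every
polynomial scale above `‖y‖^{−1−ρ}`.  WHAT THIS IS NOT: not NS, not E — a tame SUB-STRATUM; 19832 OPEN.  [folklore; length–area, t36/t36d]
-/

noncomputable section

set_option linter.dupNamespace false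

open MeasureTheory Set Filter Topology Metric Function Real
open scoped RealInnerProductSpace ENNReal NNReal

namespace Summit.NavierStokesRegularity.NavierStokesRegularity.Theorems.PowerGaugeEulerLiouville.NeedleCorePersistence

open NeedleDiscChart NeedleThinness Literature.Analysis Literature.Analysis.FluidPDE
open NeedleGradientGrowth (exists_orthonormal_frame discChart_mem_ball_of_short tendsto_rpow_mul_exp_neg_rpow aux_fit)

/-! ## The profile theorem -/

/-- **CORE PERSISTENCE AT A POLYNOMIAL SCALE IS TAME (profile level).**  Let `V : ℝ³ → ℝ³` be `C¹` with the A-growth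
`∫⁻_{B_L} ‖V‖ₑ² ≤ c L^{1−2ρ}` (`L > 0`), the op-norm E-weight `∫⁻ ‖∇V(y)‖ₑ² ‖y‖^{ρ−1} dy ≤ C`, `0 < ρ < 1`, and (CoreP): at every
fast-inflow point `y` (`⟪y, V y⟫ < −κ‖y‖²`, `‖y‖ ≥ R₀`) the radial inflow persists at half strength, `⟪y, V y'⟫ ≤ −(κ/2)‖y‖²`, for
`‖y' − y‖ ≤ K‖y‖^{1−q}` (`K > 0`, `q < 2 + ρ`).  Then there are no fast-inflow points far out: `−κ‖y‖² ≤ ⟪y, V y⟫` for all large `‖y‖`.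
Proof: the needle-thinness kernel on the coaxial cylinder of height and radius `r/2`, `r = K₁‖y‖^{1−q₁}` (`q₁ = max q 1`,
`K₁ = min K (1/4)`), inside the persistent core ball gives `r/2 ≤ 3‖y‖·exp(−B₁ ‖y‖^{2+ρ−q₁})`, impossible for large `‖y‖`.
[folklore; length–area method, t36/t36d] -/
theorem radialBarrier_of_corePersistence {ρ : ℝ} (hρ : 0 < ρ) (hρ1 : ρ < 1) {c : ℝ≥0} {C : ℝ}
    {V : EuclideanSpace ℝ (Fin 3) → EuclideanSpace ℝ (Fin 3)} (hV : ContDiff ℝ 1 V)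
    (hA : ∀ L : ℝ, 0 < L → ∫⁻ y in ball (0 : EuclideanSpace ℝ (Fin 3)) L, ‖V y‖ₑ ^ 2 ≤
      (c : ℝ≥0∞) * ENNReal.ofReal (L ^ (1 - 2 * ρ)))
    (hE : ∫⁻ y, ‖fderiv ℝ V y‖ₑ ^ 2 * ENNReal.ofReal (‖y‖ ^ (ρ - 1)) ≤ ENNReal.ofReal C)
    {κ q K R₀ : ℝ} (hκ : 0 < κ) (hq : q < 2 + ρ) (hK : 0 < K)
    (hcoreP : ∀ y : EuclideanSpace ℝ (Fin 3), R₀ ≤ ‖y‖ → ⟪y, V y⟫ < -(κ * ‖y‖ ^ 2) →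
      ∀ y' : EuclideanSpace ℝ (Fin 3), ‖y' - y‖ ≤ K * ‖y‖ ^ (1 - q) → ⟪y, V y'⟫ ≤ -(κ / 2 * ‖y‖ ^ 2)) :
    ∃ R₁ : ℝ, ∀ y : EuclideanSpace ℝ (Fin 3), R₁ ≤ ‖y‖ → -(κ * ‖y‖ ^ 2) ≤ ⟪y, V y⟫ := by
  -- constants
  obtain ⟨q₁, hq₁⟩ : ∃ q₁ : ℝ, q₁ = max q 1 := ⟨_, rfl⟩
  have hqq₁ : q ≤ q₁ := by rw [hq₁]; exact le_max_left _ _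
  have hq₁1 : 1 ≤ q₁ := by rw [hq₁]; exact le_max_right _ _
  have hq₁3 : q₁ ≤ 3 := by rw [hq₁]; exact max_le (by linarith) (by norm_num)
  have hθ0 : 0 < 2 + ρ - q₁ := by rw [hq₁]; have := max_lt hq (by linarith : (1 : ℝ) < 2 + ρ); linarith
  obtain ⟨K₁, hK₁⟩ : ∃ K₁ : ℝ, K₁ = min K (1 / 4) := ⟨_, rfl⟩
  have hK₁0 : 0 < K₁ := by rw [hK₁]; exact lt_min hK (by norm_num)
  have hK₁K : K₁ ≤ K := by rw [hK₁]; exact min_le_left _ _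
  have hK₁4 : K₁ ≤ 1 / 4 := by rw [hK₁]; exact min_le_right _ _
  obtain ⟨C₁, hC₁⟩ : ∃ C₁ : ℝ, C₁ = max C 0 + 1 := ⟨_, rfl⟩
  have hC₁0 : 0 < C₁ := by rw [hC₁]; positivity
  have hCC₁ : C ≤ C₁ := by rw [hC₁]; exact (le_max_left C 0).trans (le_add_of_nonneg_right zero_le_one)
  obtain ⟨B₁, hB₁⟩ : ∃ B₁ : ℝ, B₁ = π * κ ^ 2 * K₁ / (1024 * C₁) := ⟨_, rfl⟩
  have hB₁0 : 0 < B₁ := by rw [hB₁]; positivity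
  obtain ⟨A₂, hA₂⟩ : ∃ A₂ : ℝ, A₂ = 65536 * (3 * (c : ℝ) + 1) / (1575 * π * κ ^ 2 * K₁) := ⟨_, rfl⟩
  -- the eventual inequality «exponential beats power»
  have hev : ∀ᶠ s : ℝ in atTop, 6 * (s ^ q₁ * Real.exp (-(B₁ * s ^ (2 + ρ - q₁)))) < K₁ := by
    have ht := (tendsto_rpow_mul_exp_neg_rpow (a := q₁) hB₁0 hθ0).const_mul 6
    rw [mul_zero] at ht
    exact ht.eventually (Iio_mem_nhds hK₁0)
  obtain ⟨R₂, hR₂⟩ := eventually_atTop.1 hev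
  refine ⟨max (max 1 A₂) (max R₀ R₂), fun y hy => ?_⟩
  -- a fast point `y`, `‖y‖ = s`
  by_contra hlt0
  have hlt1 := lt_of_not_ge hlt0
  obtain ⟨s, hs⟩ : ∃ s : ℝ, s = ‖y‖ := ⟨_, rfl⟩
  rw [← hs] at hy hlt1
  have hs1 : 1 ≤ s := ((le_max_left _ _).trans (le_max_left _ _)).trans hy
  have hsA₂ : A₂ ≤ s := ((le_max_right _ _).trans (le_max_left _ _)).trans hy
  have hsR₀ : R₀ ≤ s := ((le_max_left _ _).trans (le_max_right _ _)).trans hy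
  have hev_s := hR₂ s (((le_max_right _ _).trans (le_max_right _ _)).trans hy)
  have hs0 : 0 < s := by linarith
  have hsne : s ≠ 0 := hs0.ne'
  have hsA : 65536 * (3 * (c : ℝ) + 1) ≤ 1575 * π * κ ^ 2 * K₁ * s := by
    rw [hA₂, div_le_iff₀ (by positivity)] at hsA₂
    linarith only [hsA₂]
  -- the unit vector and the frame
  obtain ⟨e, he_def⟩ : ∃ e : EuclideanSpace ℝ (Fin 3), e = s⁻¹ • y := ⟨_, rfl⟩
  have he : ‖e‖ = 1 := by
    rw [he_def, norm_smul, norm_inv, Real.norm_eq_abs, abs_of_pos hs0, ← hs, inv_mul_cancel₀ hsne]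
  have hye : y = s • e := by rw [he_def, smul_smul, mul_inv_cancel₀ hsne, one_smul]
  obtain ⟨e₁, e₂, hon⟩ := exists_orthonormal_frame he
  -- the scale `r = K₁ s^{1−q₁}`
  obtain ⟨r, hr_def⟩ : ∃ r : ℝ, r = K₁ * s ^ (1 - q₁) := ⟨_, rfl⟩
  have hr0 : 0 < r := by rw [hr_def]; exact mul_pos hK₁0 (Real.rpow_pos_of_pos hs0 _)
  have hrK₁ : K₁ * s ^ (1 - q₁) ≤ r := hr_def.ge
  have hrK : r ≤ K * s ^ (1 - q) := by
    rw [hr_def]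
    have h1 : s ^ (1 - q₁) ≤ s ^ (1 - q) := Real.rpow_le_rpow_of_exponent_le hs1 (by linarith)
    exact mul_le_mul hK₁K h1 (Real.rpow_pos_of_pos hs0 _).le hK.le
  have hrs : r ≤ s / 4 := by
    rw [hr_def]
    have h1 : s ^ (1 - q₁) ≤ s ^ (0 : ℝ) := Real.rpow_le_rpow_of_exponent_le hs1 (by linarith)
    rw [Real.rpow_zero] at h1
    have h2 : K₁ * s ^ (1 - q₁) ≤ 1 / 4 * 1 := mul_le_mul hK₁4 h1 (Real.rpow_pos_of_pos hs0 _).le (by norm_num)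
    linarith only [h2, hs1]
  -- the core on the ball `B(y, r)` from core persistence at the fast point `y`
  have hlt_y : ⟪y, V y⟫ < -(κ * ‖y‖ ^ 2) := by rw [← hs]; exact hlt1
  have hball : ∀ y' ∈ ball y r, κ * s / 2 ≤ -⟪e, V y'⟫ := by
    intro y' hy'
    rw [mem_ball, dist_eq_norm] at hy'
    have hP : ⟪y, V y'⟫ ≤ -(κ / 2 * s ^ 2) := by
      have h := hcoreP y (by rw [← hs]; exact hsR₀) hlt_y y' (by rw [← hs]; exact hy'.le.trans hrK)
      rwa [← hs] at h
    have h1 : ⟪y, V y'⟫ = s * ⟪e, V y'⟫ := by rw [← real_inner_smul_left, ← hye]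
    rw [h1] at hP
    have h2 : s * ⟪e, V y'⟫ ≤ s * (-(κ / 2 * s)) := by
      have e1 : s * (-(κ / 2 * s)) = -(κ / 2 * s ^ 2) := by ring
      rw [e1]
      exact hP
    have h3 : ⟪e, V y'⟫ ≤ -(κ / 2 * s) := le_of_mul_le_mul_left h2 hs0
    linarith only [h3]
  -- kernel data
  have hs₀0 : 0 < s - r / 4 := by linarith
  have hh0 : 0 < r / 2 := by positivity
  have hκk0 : 0 < κ / 2 := by positivity
  have h3s : 0 < 3 * s := by positivity
  have h𝓔0 : 0 < (3 * s) ^ (1 - ρ) * C₁ := by positivity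
  have h𝓐0 : 0 < (c : ℝ) * (3 * s) ^ (1 - 2 * ρ) + 1 := by positivity
  obtain ⟨D, hD_def⟩ : ∃ D : ℝ,
      D = 32 * ((c : ℝ) * (3 * s) ^ (1 - 2 * ρ) + 1) / ((κ / 2) ^ 2 * (s - r / 4) ^ 2 * (r / 2)) / π :=
    ⟨_, rfl⟩
  have hD0 : 0 < D := by rw [hD_def]; positivity
  obtain ⟨δ, hδ_def⟩ : ∃ δ : ℝ, δ = Real.sqrt ((r / 2) ^ 2 + D) := ⟨_, rfl⟩
  have hδsq : δ ^ 2 = (r / 2) ^ 2 + D := by rw [hδ_def]; exact Real.sq_sqrt (by positivity)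
  have hδ0 : 0 ≤ δ := by rw [hδ_def]; exact Real.sqrt_nonneg _
  have hwδ : r / 2 < δ := by
    rw [hδ_def, Real.lt_sqrt hh0.le]
    linarith only [hD0]
  have hbudget : 32 * ((c : ℝ) * (3 * s) ^ (1 - 2 * ρ) + 1) / ((κ / 2) ^ 2 * (s - r / 4) ^ 2 * (r / 2)) ≤
      π * (δ ^ 2 - (r / 2) ^ 2) := by
    rw [hδsq, add_sub_cancel_left, hD_def, mul_div_cancel₀ _ Real.pi_pos.ne']
  -- the ball budgets at radius `R = 3s`
  have hEball : ∫⁻ y in ball (0 : EuclideanSpace ℝ (Fin 3)) (3 * s), ‖fderiv ℝ V y‖ₑ ^ 2 ≤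
      ENNReal.ofReal ((3 * s) ^ (1 - ρ) * C₁) := by
    refine (NeedleThinCore.lintegral_ball_fderiv_sq_le_of_opWeight hρ1 hE h3s).trans ?_
    rw [← ENNReal.ofReal_mul (by positivity)]
    exact ENNReal.ofReal_le_ofReal (mul_le_mul_of_nonneg_left hCC₁ (by positivity))
  have hAball : ∫⁻ y in ball (0 : EuclideanSpace ℝ (Fin 3)) (3 * s), ‖V y‖ₑ ^ 2 ≤
      ENNReal.ofReal ((c : ℝ) * (3 * s) ^ (1 - 2 * ρ) + 1) := by
    refine (hA (3 * s) h3s).trans ?_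
    rw [← ENNReal.ofReal_coe_nnreal, ← ENNReal.ofReal_mul (NNReal.coe_nonneg c)]
    exact ENNReal.ofReal_le_ofReal (le_add_of_nonneg_right zero_le_one)
  -- the cylinder and its disc fit in `B(0, 3s)`
  have hD7 : D ≤ 7 * s ^ 2 := by
    rw [hD_def]
    exact NeedleOscillationTame.aux_budget_le hs1 hκ hK₁0 (NNReal.coe_nonneg c) hρ.le hq₁3 hr0 hrs hrK₁ hsA
  have hR : (s - r / 4 + r / 2) ^ 2 + δ ^ 2 ≤ (3 * s) ^ 2 := aux_fit hs0.le hr0.le hrs hD7 hδsq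
  -- the core hypothesis on the short cylinder
  have hcore : ∀ t ∈ Ioo (s - r / 4) (s - r / 4 + r / 2), ∀ z : ℂ, ‖z‖ ≤ r / 2 →
      κ / 2 * (s - r / 4) ≤ -⟪e, V (discChart (t • e) e₁ e₂ z)⟫ := by
    intro t ht z hz
    have hmem : discChart (t • e) e₁ e₂ z ∈ ball (s • e) r := discChart_mem_ball_of_short hon hr0 ht hz
    rw [← hye] at hmem
    have hin := hball _ hmem
    have : κ * (s - r / 4) ≤ κ * s := mul_le_mul_of_nonneg_left (by linarith) hκ.le
    linarith only [hin, this]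
  -- THE KERNEL
  have hVd : Differentiable ℝ V := hV.differentiable one_ne_zero
  have hker := needle_inradius_le_radial (V' := fderiv ℝ V) (fun y => (hVd y).hasFDerivAt)
    (hV.continuous_fderiv one_ne_zero) hon hs₀0 hh0 hh0 hwδ hκk0 h3s hR h𝓔0 h𝓐0 hEball hAball hbudget hcore
  -- the exponent dominates `B₁ s^{2+ρ−q₁}`
  have hX : B₁ * s ^ (2 + ρ - q₁) ≤
      π * (κ / 2 * (s - r / 4)) ^ 2 * (r / 2) / (16 * ((3 * s) ^ (1 - ρ) * C₁)) := by
    rw [hB₁]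
    exact NeedleOscillationTame.aux_exponent_ge hs1 hκ hK₁0 hC₁0 hρ.le hr0 hrs hrK₁
  -- `r/2 ≤ δ e^{−X} ≤ 3 s e^{−B₁ s^θ}`
  have hδ3 : δ ≤ 3 * s := by
    have : δ ^ 2 ≤ (3 * s) ^ 2 := by linarith only [hR, sq_nonneg (s - r / 4 + r / 2)]
    exact (pow_le_pow_iff_left₀ hδ0 (by positivity) two_ne_zero).1 this
  have hw3 : r / 2 ≤ 3 * s * Real.exp (-(B₁ * s ^ (2 + ρ - q₁))) := by
    calc r / 2 ≤ δ * Real.exp (-(π * (κ / 2 * (s - r / 4)) ^ 2 * (r / 2) / (16 * ((3 * s) ^ (1 - ρ) * C₁)))) :=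
          hker
      _ ≤ δ * Real.exp (-(B₁ * s ^ (2 + ρ - q₁))) :=
          mul_le_mul_of_nonneg_left (Real.exp_le_exp.2 (neg_le_neg hX)) hδ0
      _ ≤ 3 * s * Real.exp (-(B₁ * s ^ (2 + ρ - q₁))) := mul_le_mul_of_nonneg_right hδ3 (Real.exp_pos _).le
  exact NeedleOscillationTame.aux_contra hs0 hrK₁ hw3 hev_s

/-! ## The member corollary -/

/-- **CORE PERSISTENCE AT A POLYNOMIAL SCALE IS TAME (member level).**  Under the crux hypotheses verbatim (suitable weak Euler
solution on `ℝ³ × (−∞,0)` with weak spatial gradient `H` and the three power gauges `a^{2ρ}A + a^ρ E + a^{2ρ}D ≤ c`), exact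
self-similarity `u(τ) = (−τ)^{γ−1} V((−τ)^{−γ} ·)`, `p(τ) = (−τ)^{2γ−2} P((−τ)^{−γ} ·)`, `γ = 1/(2+ρ)`, in the window `0 < ρ ≤ 1/2`, a `C²`
profile, a strength `0 < κ < γ`, a scale exponent `q < 2+ρ` and `K > 0`: if at every far fast-inflow point `y` (`⟪y, V y⟫ < −κ‖y‖²`)
the radial inflow persists, `⟪y, V y'⟫ ≤ −(κ/2)‖y‖²` for `‖y' − y‖ ≤ K‖y‖^{1−q}`, then the member is trivial
(`radialBarrier_of_corePersistence` with the inputs `NeedleThinCore.selfSimilar_needle_inputs`, then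
`Loc.selfSimilar_ae_eq_zero_of_radialInflowC2_profile`).  The registered needle's cores are thinner than every polynomial scale
`‖y‖^{1−q}`, `q < 2+ρ`. [folklore] -/
theorem selfSimilar_ae_eq_zero_of_corePersistence {ρ : ℝ} (hρ : 0 < ρ) (hρh : ρ ≤ 1 / 2)
    {u : ℝ → EuclideanSpace ℝ (Fin 3) → EuclideanSpace ℝ (Fin 3)} {p : ℝ → EuclideanSpace ℝ (Fin 3) → ℝ}
    {H : ℝ → EuclideanSpace ℝ (Fin 3) → EuclideanSpace ℝ (Fin 3) →L[ℝ] EuclideanSpace ℝ (Fin 3)} {c : ℝ≥0}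
    (hsw : IsSuitableWeakSolutionOn (slab (EuclideanSpace ℝ (Fin 3)) (Iio 0) isOpen_Iio) 0 0 u p)
    (hH : HasWeakSpatialGradientOn (slab (EuclideanSpace ℝ (Fin 3)) (Iio 0) isOpen_Iio) u H)
    (hgauge : ∀ a : ℝ, 0 < a →
      ENNReal.ofReal (a ^ (2 * ρ)) * cknA a (0 : ℝ × EuclideanSpace ℝ (Fin 3)) u +
          ENNReal.ofReal (a ^ ρ) * cknE a (0 : ℝ × EuclideanSpace ℝ (Fin 3)) H +
        ENNReal.ofReal (a ^ (2 * ρ)) * cknD a (0 : ℝ × EuclideanSpace ℝ (Fin 3)) p ≤ (c : ℝ≥0∞))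
    {V : EuclideanSpace ℝ (Fin 3) → EuclideanSpace ℝ (Fin 3)} {P : EuclideanSpace ℝ (Fin 3) → ℝ}
    (hu : ∀ τ : ℝ, τ < 0 → u τ = selfSimilarCollapse (1 / (2 + ρ)) 0 V τ)
    (hp : ∀ τ : ℝ, τ < 0 → p τ = selfSimilarCollapsePressure (1 / (2 + ρ)) 0 P τ)
    (hV : ContDiff ℝ 2 V) {κ q K R₀ : ℝ} (hκ : 0 < κ) (hκγ : κ < 1 / (2 + ρ)) (hq : q < 2 + ρ) (hK : 0 < K)
    (hcoreP : ∀ y : EuclideanSpace ℝ (Fin 3), R₀ ≤ ‖y‖ → ⟪y, V y⟫ < -(κ * ‖y‖ ^ 2) →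
      ∀ y' : EuclideanSpace ℝ (Fin 3), ‖y' - y‖ ≤ K * ‖y‖ ^ (1 - q) → ⟪y, V y'⟫ ≤ -(κ / 2 * ‖y‖ ^ 2)) :
    uncurry u =ᵐ[volume.restrict (Iio (0 : ℝ) ×ˢ (univ : Set (EuclideanSpace ℝ (Fin 3))))] 0 := by
  have hρ1 : ρ < 1 := by linarith
  have hV1 : ContDiff ℝ 1 V := hV.of_le one_le_two
  obtain ⟨hA, hE⟩ := NeedleThinCore.selfSimilar_needle_inputs hρ hρ1 hsw hH hgauge hu hp hV1
  obtain ⟨R₁, hR₁⟩ := radialBarrier_of_corePersistence hρ hρ1 hV1 hA hE hκ hq hK hcoreP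
  exact Loc.selfSimilar_ae_eq_zero_of_radialInflowC2_profile hρ hρh hsw hgauge hu hp hV hκγ hR₁

/-! ## (Osc) ⇒ (CoreP) -/

/-- The oscillation bound (Osc) of `…NeedleOscillationTame` implies core persistence (CoreP) at the same scale:
`‖V y' − V y‖ ≤ (κ/2)‖y‖` gives `⟪y, V y'⟫ ≤ ⟪y, V y⟫ + (κ/2)‖y‖² < −(κ/2)‖y‖²` at a fast point. [folklore] -/
theorem corePersistence_of_oscTame {V : EuclideanSpace ℝ (Fin 3) → EuclideanSpace ℝ (Fin 3)} {κ q K R₀ : ℝ}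
    (hosc : ∀ y : EuclideanSpace ℝ (Fin 3), R₀ ≤ ‖y‖ → ∀ y' : EuclideanSpace ℝ (Fin 3),
      ‖y' - y‖ ≤ K * ‖y‖ ^ (1 - q) → ‖V y' - V y‖ ≤ κ / 2 * ‖y‖) :
    ∀ y : EuclideanSpace ℝ (Fin 3), R₀ ≤ ‖y‖ → ⟪y, V y⟫ < -(κ * ‖y‖ ^ 2) →
      ∀ y' : EuclideanSpace ℝ (Fin 3), ‖y' - y‖ ≤ K * ‖y‖ ^ (1 - q) → ⟪y, V y'⟫ ≤ -(κ / 2 * ‖y‖ ^ 2) := by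
  intro y hy hfast y' hy'
  have h1 : ⟪y, V y'⟫ - ⟪y, V y⟫ ≤ ‖y‖ * ‖V y' - V y‖ := by
    rw [← inner_sub_right]
    exact real_inner_le_norm _ _
  have h2 : ‖y‖ * ‖V y' - V y‖ ≤ ‖y‖ * (κ / 2 * ‖y‖) := mul_le_mul_of_nonneg_left (hosc y hy y' hy') (norm_nonneg y)
  have e : ‖y‖ * (κ / 2 * ‖y‖) = κ / 2 * ‖y‖ ^ 2 := by ring
  linarith only [h1, h2, e, hfast]

end Summit.NavierStokesRegularity.NavierStokesRegularity.Theorems.PowerGaugeEulerLiouville.NeedleCorePersistence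

end
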